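import Summits.Ventures.PercRepro.S1LowRankSetsCount

/-!
# PercRepro — THE RANK PROFILE OF RANK 7 ON 11 POINTS: THE `f`-BOUNDS, THE COMPLEMENTS AND THE KILLS (p2, gen 28;
SUBCLAIM-S1 §6.10 (xvii)(q); towards the `(9, 6)` shapes)

For a coloop-free simple rank-`7` matroid on `11` points: `f(n) ≥ Σ_k #rkSets k n` over the sizes, `f(7) ≥ 1 + …`;
the complements `N(7, 4) ≤ s₇`, `N(7, 3) ≤ q₃ + s₈`, `N(7, 2) ≤ q₂ + t + s₉`; the up/down kill chains as
inequalities between the `rkSets` counts. Nothing is claimed about any cell.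

* `f_ge_rank_seven_eleven`, `complements_rank_seven_eleven`, `kills_up_rank_seven_eleven`, `kills_down_rank_seven_eleven`.
Axioms: standard.
-/

open scoped Matroid

namespace PercRepro

namespace S1

open Set

variable {α : Type} {M : Matroid α} [M.Finite]

/-- Four classes of distinct sizes inside `rankSet n`. -/
theorem four_rkSets_le_rankSet (a b c d n : ℕ) (hab : a ≠ b) (hac : a ≠ c) (had : a ≠ d) (hbc : b ≠ c) (hbd : b ≠ d)
    (hcd : c ≠ d) :
    (rkSets M a n).ncard + (rkSets M b n).ncard + (rkSets M c n).ncard + (rkSets M d n).ncard ≤ (rankSet M n).ncard := by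
  have hsub : rkSets M a n ∪ rkSets M b n ∪ rkSets M c n ∪ rkSets M d n ⊆ rankSet M n := by
    rintro A (((hA | hA) | hA) | hA) <;> exact rkSets_subset_rankSet _ _ hA
  have h := ncard_le_ncard hsub (rankSet_finite M n)
  rw [ncard_union_eq (by rw [Set.disjoint_left]; rintro A ((⟨-, h1, -⟩ | ⟨-, h2, -⟩) | ⟨-, h3, -⟩) ⟨-, h4, -⟩ <;> omega)
      (((rkSets_finite a n).union (rkSets_finite b n)).union (rkSets_finite c n)) (rkSets_finite d n),
    ncard_union_eq (by rw [Set.disjoint_left]; rintro A (⟨-, h1, -⟩ | ⟨-, h2, -⟩) ⟨-, h3, -⟩ <;> omega)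
      ((rkSets_finite a n).union (rkSets_finite b n)) (rkSets_finite c n),
    ncard_union_eq (by rw [Set.disjoint_left]; rintro A ⟨-, h1, -⟩ ⟨-, h2, -⟩; omega) (rkSets_finite a n)
      (rkSets_finite b n)] at h
  exact h

/-- Five classes of distinct sizes inside `rankSet n`. -/
theorem five_rkSets_le_rankSet (a b c d e n : ℕ) (hab : a ≠ b) (hac : a ≠ c) (had : a ≠ d) (hae : a ≠ e) (hbc : b ≠ c)
    (hbd : b ≠ d) (hbe : b ≠ e) (hcd : c ≠ d) (hce : c ≠ e) (hde : d ≠ e) :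
    (rkSets M a n).ncard + (rkSets M b n).ncard + (rkSets M c n).ncard + (rkSets M d n).ncard + (rkSets M e n).ncard ≤
      (rankSet M n).ncard := by
  have hsub : rkSets M a n ∪ rkSets M b n ∪ rkSets M c n ∪ rkSets M d n ∪ rkSets M e n ⊆ rankSet M n := by
    rintro A ((((hA | hA) | hA) | hA) | hA) <;> exact rkSets_subset_rankSet _ _ hA
  have h := ncard_le_ncard hsub (rankSet_finite M n)
  rw [ncard_union_eq (by
        rw [Set.disjoint_left]; rintro A (((⟨-, h1, -⟩ | ⟨-, h2, -⟩) | ⟨-, h3, -⟩) | ⟨-, h4, -⟩) ⟨-, h5, -⟩ <;> omega)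
      ((((rkSets_finite a n).union (rkSets_finite b n)).union (rkSets_finite c n)).union (rkSets_finite d n))
      (rkSets_finite e n),
    ncard_union_eq (by rw [Set.disjoint_left]; rintro A ((⟨-, h1, -⟩ | ⟨-, h2, -⟩) | ⟨-, h3, -⟩) ⟨-, h4, -⟩ <;> omega)
      (((rkSets_finite a n).union (rkSets_finite b n)).union (rkSets_finite c n)) (rkSets_finite d n),
    ncard_union_eq (by rw [Set.disjoint_left]; rintro A (⟨-, h1, -⟩ | ⟨-, h2, -⟩) ⟨-, h3, -⟩ <;> omega)
      ((rkSets_finite a n).union (rkSets_finite b n)) (rkSets_finite c n),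
    ncard_union_eq (by rw [Set.disjoint_left]; rintro A ⟨-, h1, -⟩ ⟨-, h2, -⟩; omega) (rkSets_finite a n)
      (rkSets_finite b n)] at h
  exact h

/-- The `f`-bounds by sizes on `11` points of rank `7` (`f(7)` counts `E` through `rkSets 11 7`). -/
theorem f_ge_rank_seven_eleven (hM : M.eRank = ((7 : ℕ) : ℕ∞)) (hE : M.E.ncard = 11) (hcol : M.coloops = ∅)
    (hpairs : ∀ e ∈ M.E, ∀ f ∈ M.E, e ≠ f → M.eRk {e, f} = 2) :
    (rkSets M 3 3).ncard + (rkSets M 4 3).ncard + (rkSets M 5 3).ncard + (rkSets M 6 3).ncard ≤ (rankSet M 3).ncard ∧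
    (rkSets M 4 4).ncard + (rkSets M 5 4).ncard + (rkSets M 6 4).ncard + (rkSets M 7 4).ncard ≤ (rankSet M 4).ncard ∧
    (rkSets M 5 5).ncard + (rkSets M 6 5).ncard + (rkSets M 7 5).ncard + (rkSets M 8 5).ncard ≤ (rankSet M 5).ncard ∧
    (rkSets M 6 6).ncard + (rkSets M 7 6).ncard + (rkSets M 8 6).ncard + (rkSets M 9 6).ncard ≤ (rankSet M 6).ncard ∧
    1 + (rkSets M 10 7).ncard + (rkSets M 9 7).ncard + (rkSets M 8 7).ncard + (rkSets M 7 7).ncard ≤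
      (rankSet M 7).ncard := by
  refine ⟨four_rkSets_le_rankSet 3 4 5 6 3 (by omega) (by omega) (by omega) (by omega) (by omega) (by omega),
    four_rkSets_le_rankSet 4 5 6 7 4 (by omega) (by omega) (by omega) (by omega) (by omega) (by omega),
    four_rkSets_le_rankSet 5 6 7 8 5 (by omega) (by omega) (by omega) (by omega) (by omega) (by omega),
    four_rkSets_le_rankSet 6 7 8 9 6 (by omega) (by omega) (by omega) (by omega) (by omega) (by omega), ?_⟩
  have h11 : 1 ≤ (rkSets M 11 7).ncard := by
    have := choose_le_rank_classes_eleven hM hE hcol hpairs 11 (by norm_num)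
    rw [rankTwoSets_eq_empty_of_big_eleven hM hE hcol (k := 11) (by norm_num),
      rkSets_eq_empty_of_big_eleven hM hE hcol (k := 11) (n := 3) (by norm_num) (by norm_num),
      rkSets_eq_empty_of_big_eleven hM hE hcol (k := 11) (n := 4) (by norm_num) (by norm_num),
      rkSets_eq_empty_of_big_eleven hM hE hcol (k := 11) (n := 5) (by norm_num) (by norm_num),
      rkSets_eq_empty_of_big_eleven hM hE hcol (k := 11) (n := 6) (by norm_num) (by norm_num), ncard_empty,
      show Nat.choose 11 11 = 1 by decide] at this
    omega
  have h5 := five_rkSets_le_rankSet (M := M) 11 10 9 8 7 7 (by omega) (by omega) (by omega) (by omega) (by omega)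
    (by omega) (by omega) (by omega) (by omega) (by omega)
  omega

/-- One upward kill, as a template: `7 · #low₄(≤ 3) ≤ 5 · #low₅(≤ 4)` in `rkSets` form. -/
theorem kill_up_four_three (hE : M.E.ncard = 11) (hpairs : ∀ e ∈ M.E, ∀ f ∈ M.E, e ≠ f → M.eRk {e, f} = 2) :
    7 * ((rankTwoSets M 4).ncard + (rkSets M 4 3).ncard) ≤
      5 * ((rankTwoSets M 5).ncard + (rkSets M 5 3).ncard + (rkSets M 5 4).ncard) := by
  have h := sub_mul_ncard_lowRankSets_le M 4 3
  rw [hE, ncard_lowRankSets_eq hpairs (by norm_num) 3 (by norm_num),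
    ncard_lowRankSets_eq hpairs (by norm_num) (3 + 1) (by norm_num)] at h
  simp only [Finset.sum_range_succ, Finset.sum_range_zero, show (3 : ℕ) - 2 = 1 from rfl,
    show (3 + 1 : ℕ) - 2 = 2 from rfl, zero_add] at h
  norm_num at h
  omega

end S1

end PercRepro
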